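import Summits.RiemannHypothesis.RiemannHypothesis.Theorems.WeilFormatCDataA1RungCB
import Summits.RiemannHypothesis.RiemannHypothesis.Theorems.WeilWindowFlowGronwallLeakageStrictAnti
import Summits.RiemannHypothesis.RiemannHypothesis.Theorems.IntegerScrewWeilWindowGroundEnergyFloor
import Literature.NumberTheory.LFunctions.WeilOddGroundState
import Literature.NumberTheory.LFunctions.WeilGroundEnergyParitySplit
import HarnessLib

/-!
# STRICT Weil positivity on every window strictly inside the certified rung `a = 1` (RH-FREE)

LADDER-RH column WEIL, row W-A1 (`WeilFormatCData.A1.weilPositivityOn_one : WeilPositivityOn 1`, format C,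
weil-2 p393632): the certificate proves `0 ≤ Re Q(g)` for every test function `g` of Yoshida's class `C(1)`
(smooth, `tsupport g ⊆ [-1, 1]`), i.e. `0 ≤ ε(1)` for Bombieri's ground energy `ε = weilGroundEnergy`, and
NO strict margin at `a = 1` (the writer's note `main-a1` v1.4 §9.1: "no definiteness statement is produced").

This file records what the tree nevertheless gives STRICTLY, by composing the rung with the unconditional
strict antitonicity of the window bottom (`WeilWindowFlowGronwallLeakage.weilGroundEnergy_strictAntiOn`,
translation invariance + the Connes–Consani–Moscovici compactness theorem; in the tree since 2026-08-16):

* `weilGroundEnergy_pos_of_lt_one` — **`0 < ε(a)` for every `0 < a < 1`**; equivalently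
  (`re_weilQuadratic_pos_of_lt_one`) `0 < Re Q(g)` for every non-zero `g ∈ C(a)`, `a < 1`, and
  (`exists_pos_coercive_of_lt_one`) `L²`-COERCIVITY `c‖g‖₂² ≤ Re Q(g)` on `C(a)` with some `c > 0`;
  both parity sectors inherit it (`weilEvenGroundEnergy_pos_of_lt_one`, `weilOddGroundEnergy_pos_of_lt_one`).
* Dictionary instances (rh-columns `LIT-COLUMNS.md` §6D: the self-published "Suzuki-localized-form" records
  of 18–23 Aug 2026 claim exactly `0 < λ_a = weilGroundEnergy a` at windows `a < 1`): the widest such window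
  `a₇ = ½ log 7.01 = 0.97367` (`weilGroundEnergy_pos_log_701_div_100_half`, and `∀ 0 < a ≤ a₇` in
  `weilGroundEnergy_pos_of_le_log_701_div_100_half`), the window `½ log 7` in both sectors
  (`weilGroundEnergy_pos_log_seven_half`, `weilOddGroundEnergy_pos_log_seven_half`). These are KERNEL
  COROLLARIES of W-A1; strictness AT `a = 1` itself is not claimed (it needs a margin certificate,
  `WeilFormatCSectorMargin.le_weilGroundEnergy_of_gramCoeff_shifted_sector_nonneg`).
* SCREW dictionary (route `IntegerScrew`, pivot-theory's `IntegerScrewWeilWindowGroundEnergyFloor`): the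
  balanced-window floor `(ε(a)/(4M))·Σ x_m² ≤ Σ G(log m, log m') x_m x_{m'}` now comes with a POSITIVE constant
  RH-FREE for every log-length `2a < 2` (`screwWindow_coercive_of_lt_one`), in particular for every ratio
  `M < R(N+1)` with `2 ≤ R ≤ 7` (`screwWindow_ratio_coercive_of_le_seven`) — that file's docstring had
  "at ratio ≤ 7 only ε ≥ 0 is certified"; the RH-CONDITIONAL version there covers all ratios.

Labels: everything here is RH-FREE (upper-side positivity strictly inside a certified window). `WeilPositivityOn a`
for EVERY `a` is Weil's criterion (RH-EQUIVALENT); nothing here bears on the truth of RH.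
No new certificate, no kit job: two landed theorems composed (writer seat rh-explicit-weil-1 gen25).

References: E. Bombieri, Rend. Lincei (9) 11 (2000) §4 (ε, Problems 1–2) [Bombieri2000Weil]; H. Yoshida,
Adv. Stud. Pure Math. 21 (1992) [Yoshida1992HermitianForms]; M. Suzuki, arXiv:2606.09096 (1.7), Cor. 1.2
(λ_a = the Rayleigh infimum over `C_c^∞(−a,a)`).
-/

-- `Summit.RiemannHypothesis.RiemannHypothesis.…` repeats a namespace component by design (D-0017 layout).
set_option linter.dupNamespace false

open MeasureTheory Set
open Literature.NumberTheory.LFunctions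
open Summit.RiemannHypothesis.RiemannHypothesis.Theorems.WeilWindowFlowGronwallLeakage

namespace Summit.RiemannHypothesis.RiemannHypothesis.Theorems.WeilFormatCData.A1

/-! ## §1 Strict positivity of the ground energy on every window `a < 1` -/

/-- **`0 < ε(a)` for every `0 < a < 1`** (RH-FREE): the rung `WeilPositivityOn 1` gives `0 ≤ ε(1)`, and the
window bottom is strictly decreasing (`weilGroundEnergy_pos_of_weilPositivityOn_of_lt`). [folklore] -/
theorem weilGroundEnergy_pos_of_lt_one {a : ℝ} (ha : 0 < a) (h1 : a < 1) : 0 < weilGroundEnergy a :=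
  weilGroundEnergy_pos_of_weilPositivityOn_of_lt weilPositivityOn_one ha h1

/-- The rung in ground-energy form: `0 ≤ ε(1)`. [folklore] -/
theorem weilGroundEnergy_one_nonneg : 0 ≤ weilGroundEnergy 1 :=
  (weilGroundEnergy_nonneg_iff_holds one_pos).2 weilPositivityOn_one

/-- Strict decrease towards the rung: `ε(1) < ε(a)` for every `0 < a < 1`. [folklore] -/
theorem weilGroundEnergy_one_lt_of_lt_one {a : ℝ} (ha : 0 < a) (h1 : a < 1) :
    weilGroundEnergy 1 < weilGroundEnergy a :=
  weilGroundEnergy_lt_of_lt ha h1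

/-- **`L²`-coercivity of Weil's form on `C(a)`, `a < 1`** (RH-FREE): there is `c > 0` (namely `ε(a)`) with
`c·∫‖g‖² ≤ Re Q(g)` for every test function `g` supported in `[-a, a]`. [cite: Bombieri2000Weil, §4 Problem 2] -/
theorem exists_pos_coercive_of_lt_one {a : ℝ} (ha : 0 < a) (h1 : a < 1) :
    ∃ c : ℝ, 0 < c ∧ ∀ g : ℝ → ℂ, IsWeilTest g → tsupport g ⊆ Icc (-a) a →
      c * ∫ t, ‖g t‖ ^ 2 ≤ (weilQuadratic g).re :=
  ⟨weilGroundEnergy a, weilGroundEnergy_pos_of_lt_one ha h1,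
    fun _ hg hs ↦ ConnesVanSuijlekom.weilGroundEnergy_mul_le_re hg hs⟩

/-- **Strict Weil positivity inside the rung** (RH-FREE): `0 < Re W(g ⋆ g̃)` for every NON-ZERO test function
`g` of Yoshida's class supported in `[-a, a]`, `0 < a < 1`. [folklore] -/
theorem re_weilQuadratic_pos_of_lt_one {a : ℝ} (ha : 0 < a) (h1 : a < 1) {g : ℝ → ℂ} (hg : IsWeilTest g)
    (hs : tsupport g ⊆ Icc (-a) a) (hne : g ≠ 0) : 0 < (weilQuadratic g).re := by
  have hnn : 0 ≤ ∫ t, ‖g t‖ ^ 2 := integral_nonneg fun _ ↦ by positivity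
  have hpos : 0 < ∫ t, ‖g t‖ ^ 2 :=
    lt_of_le_of_ne hnn fun h ↦ hne (hg.eq_zero_of_integral_norm_sq_eq_zero h.symm)
  exact (mul_pos (weilGroundEnergy_pos_of_lt_one ha h1) hpos).trans_le
    (ConnesVanSuijlekom.weilGroundEnergy_mul_le_re hg hs)

/-- The EVEN sector inherits strictness: `0 < ε_ev(a)` for `0 < a < 1` (`ε ≤ ε_ev`). [folklore] -/
theorem weilEvenGroundEnergy_pos_of_lt_one {a : ℝ} (ha : 0 < a) (h1 : a < 1) :
    0 < weilEvenGroundEnergy a :=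
  (weilGroundEnergy_pos_of_lt_one ha h1).trans_le (weilGroundEnergy_le_weilEvenGroundEnergy a)

/-- The ODD sector inherits strictness: `0 < ε_odd(a)` for `0 < a < 1` (`ε ≤ ε_odd`). [folklore] -/
theorem weilOddGroundEnergy_pos_of_lt_one {a : ℝ} (ha : 0 < a) (h1 : a < 1) :
    0 < weilOddGroundEnergy a :=
  (weilGroundEnergy_pos_of_lt_one ha h1).trans_le (weilGroundEnergy_le_weilOddGroundEnergy a)

/-! ## §2 Named windows (dictionary of rh-columns `LIT-COLUMNS.md` §6D) -/

/-- `e² > 7.01`, i.e. `½ log 7.01 < 1`: the prime powers below `e² = 7.389…` are `2, 3, 4, 5, 7`. [folklore] -/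
theorem log_701_div_100_half_lt_one : Real.log (701 / 100) / 2 < 1 := by
  have he := Real.exp_one_gt_d9
  have h2 : Real.exp 2 = Real.exp 1 * Real.exp 1 := by
    rw [← Real.exp_add]; norm_num
  have h : (701 / 100 : ℝ) < Real.exp 2 := by
    rw [h2]; nlinarith [Real.exp_pos 1]
  have hlog : Real.log (701 / 100) < Real.log (Real.exp 2) := Real.log_lt_log (by norm_num) h
  rw [Real.log_exp] at hlog
  linarith

/-- `½ log 7 < 1`. [folklore] -/
theorem log_seven_half_lt_one : Real.log 7 / 2 < 1 := by
  have h : Real.log 7 ≤ Real.log (701 / 100) :=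
    Real.log_le_log (by norm_num) (by norm_num)
  linarith [log_701_div_100_half_lt_one]

/-- **The window `a₇ = ½ log 7.01 = 0.97367…`** (the widest all-test-function window named in the Zenodo cluster of
LIT-COLUMNS §6D, there for Suzuki's `λ_a`, which is `weilGroundEnergy a` by arXiv:2606.09096 (1.7) + Cor. 1.2):
`0 < ε(½ log 7.01)` is a kernel corollary of W-A1. [folklore] -/
theorem weilGroundEnergy_pos_log_701_div_100_half : 0 < weilGroundEnergy (Real.log (701 / 100) / 2) :=
  weilGroundEnergy_pos_of_lt_one (by have := Real.log_pos (by norm_num : (1 : ℝ) < 701 / 100); linarith)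
    log_701_div_100_half_lt_one

/-- … and hence `0 < ε(a)` for every `0 < a ≤ ½ log 7.01`. [folklore] -/
theorem weilGroundEnergy_pos_of_le_log_701_div_100_half {a : ℝ} (ha : 0 < a)
    (h : a ≤ Real.log (701 / 100) / 2) : 0 < weilGroundEnergy a :=
  weilGroundEnergy_pos_of_lt_one ha (h.trans_lt log_701_div_100_half_lt_one)

/-- **The window `½ log 7`** (last window before the prime `7` enters): `0 < ε(½ log 7)`. [folklore] -/
theorem weilGroundEnergy_pos_log_seven_half : 0 < weilGroundEnergy (Real.log 7 / 2) :=
  weilGroundEnergy_pos_of_lt_one (by have := Real.log_pos (by norm_num : (1 : ℝ) < 7); linarith)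
    log_seven_half_lt_one

/-- The ODD sector at `½ log 7` (the odd-sector window named in LIT-COLUMNS §6D): `0 < ε_odd(½ log 7)`. [folklore] -/
theorem weilOddGroundEnergy_pos_log_seven_half : 0 < weilOddGroundEnergy (Real.log 7 / 2) :=
  weilOddGroundEnergy_pos_of_lt_one (by have := Real.log_pos (by norm_num : (1 : ℝ) < 7); linarith)
    log_seven_half_lt_one

end Summit.RiemannHypothesis.RiemannHypothesis.Theorems.WeilFormatCData.A1

/-! ## §3 SCREW dictionary: RH-FREE positive floors for Suzuki's integer matrices on windows of log-length `< 2` -/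

namespace Summit.RiemannHypothesis.RiemannHypothesis.Theorems.IntegerScrew

open Finset
open Summit.RiemannHypothesis.RiemannHypothesis.Theorems.WeilFormatCData.A1

/-- **RH-FREE positive window floor, log-length `< 2`**: for `0 < a < 1`, `0 < ε(a)` and
`(ε(a)/(4M))·Σ_{(N,M]} x_m² ≤ Σ G(log m, log m') x_m x_{m'}` for every real `x` balanced on `(N, M]` whenever
`log M − log(N+1) < 2a` (`screwWindow_groundEnergy_floor` with the strict constant of §1). [cite: Bombieri2000Weil, §4 Problem 2] -/
theorem screwWindow_coercive_of_lt_one {a : ℝ} (ha : 0 < a) (h1 : a < 1) :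
    0 < weilGroundEnergy a ∧
      ∀ N M : ℕ, Real.log M - Real.log ((N : ℝ) + 1) < 2 * a → ∀ x : ℕ → ℝ,
        ∑ m ∈ Ioc N M, x m = 0 →
          weilGroundEnergy a / (4 * M) * ∑ m ∈ Ioc N M, x m ^ 2 ≤
            ∑ m ∈ Ioc N M, ∑ m' ∈ Ioc N M,
              zetaScrewKernel (Real.log m) (Real.log m') * (x m * x m') :=
  have hε := weilGroundEnergy_pos_of_lt_one ha h1
  ⟨hε, fun N M hNM x hx ↦ screwWindow_groundEnergy_floor ha hε.le N M hNM x hx⟩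

/-- **RH-FREE ratio form, `2 ≤ R ≤ 7`**: every real vector balanced on a window `(N, M]` with `M < R(N+1)` satisfies
`(ε((log R)/2)/(4M))·Σ x_m² ≤ Σ G(log m, log m') x_m x_{m'}` with `0 < ε((log R)/2)` — uniform in `M`, exponent `1`
(the RH-CONDITIONAL `screwWindow_ratio_coercive_of_riemannHypothesis` covers every `R`). [cite: Bombieri2000Weil, §4 Problem 2] -/
theorem screwWindow_ratio_coercive_of_le_seven {R : ℕ} (hR2 : 2 ≤ R) (hR7 : R ≤ 7) (N M : ℕ)
    (hNM : M < R * (N + 1)) (x : ℕ → ℝ) (hx : ∑ m ∈ Ioc N M, x m = 0) :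
    0 < weilGroundEnergy (Real.log R / 2) ∧
      weilGroundEnergy (Real.log R / 2) / (4 * M) * ∑ m ∈ Ioc N M, x m ^ 2 ≤
        ∑ m ∈ Ioc N M, ∑ m' ∈ Ioc N M,
          zetaScrewKernel (Real.log m) (Real.log m') * (x m * x m') := by
  have hRr : (2 : ℝ) ≤ R := by exact_mod_cast hR2
  have hR7r : (R : ℝ) ≤ 7 := by exact_mod_cast hR7
  have ha : 0 < Real.log R / 2 := by
    have : 0 < Real.log R := Real.log_pos (by linarith)
    linarith
  have h1 : Real.log R / 2 < 1 := by
    have : Real.log R ≤ Real.log 7 := Real.log_le_log (by linarith) hR7r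
    linarith [log_seven_half_lt_one]
  obtain ⟨hε, h⟩ := screwWindow_coercive_of_lt_one ha h1
  refine ⟨hε, ?_⟩
  rcases le_or_gt M N with hMN | hMN
  · simp [Finset.Ioc_eq_empty_of_le hMN]
  refine h N M ?_ x hx
  have hN1 : (0 : ℝ) < (N : ℝ) + 1 := by positivity
  have hMpos : (0 : ℝ) < M := hN1.trans_le (by exact_mod_cast hMN)
  have hlt : (M : ℝ) < R * ((N : ℝ) + 1) := by exact_mod_cast hNM
  have hlog : Real.log M < Real.log (R * ((N : ℝ) + 1)) := Real.log_lt_log hMpos hlt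
  rw [Real.log_mul (by linarith) hN1.ne'] at hlog
  linarith

end Summit.RiemannHypothesis.RiemannHypothesis.Theorems.IntegerScrew
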